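import Summits.Ventures.CertifiedManyBodySolver.Theses.CovNdNiO2M22

/-!
# Ventures/CertifiedManyBodySolver — Theorems/CovNdNiO2M22Assembly.lean

The ASSEMBLY item (stmt-Ventures-23947) of the coverage route `CovNdNiO2M22` (hubbard-cov-ndnio2-2; D-0154 (1)(C) «NdNiO₂», director
ORDER (A) «M22-LITE-3», rung «MOS2-ndnio2-M22», box «Nd₀.₈Sr₀.₂NiO₂ (M22)»): `ResidualLowUSlab22 → ResidualHighUSlab22 → NdNiO2M22_StiffnessBoxCeiling`
is the curried form of the route file's gate-written deciding theorem `closes` (= `NdNiO2M22_StiffnessBoxCeiling_of_cornerCellLeaf le_rfl` ∘ the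
`le_total U (110/21)` split of the residual cell `t′ ∈ [−23/50, −11/25] × n ∈ [393/500, 409/500] × U ∈ [5, 17/2]` into its two U-slabs). Filed
under `Theorems/` by hubbard-cov-ndnio2-box-1 (g3) under the PEN's WRITE_CRUXES MAP v1 for this route (hubbard-obs STATUS 2026-08-29T01:31:15Z:
«Assembly = modus ponens, any prover … bc6-exempt assembly one-liner open to any prover»); the M21 twin is `covNdNiO2M21Assembly_proof` (p614307).
Nothing about the two cruxes is claimed here: the theorem is CONDITIONAL on them by construction (an implication), exactly as the item is typed;
both cruxes are at present «closed modulo SDP claim nodes» only (HIGH: p692859 modulo pair nodes p690365 / p692258; LOW: pending node C), which is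
NOT proved.

HONEST FRAMING: glue only — certified stiffness CEILINGS on a downfolded SCREENING-GRADE box are CONTROL / CALIBRATION + labelled heuristic
(wording class (xx1)); a ceiling never speaks to the presence or absence of superconductivity; not a `T_c` or phase statement; no rung leaf and
no summit statement is proved by this file.
-/

namespace Summit.Ventures.CertifiedManyBodySolver.Theorems

open Summit.Ventures.CertifiedManyBodySolver.Theses.CovNdNiO2M22

/-- The assembly item (stmt-Ventures-23947) of route `CovNdNiO2M22` is a free closure of the route's deciding theorem `closes`:
the low-U slab word (U ∈ [5, 110/21]) and the high-U slab word (U ∈ [110/21, 17/2]) on the residual cell of `boxNdSrNiO2E_M22` give the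
registered rung leaf `NdNiO2M22_StiffnessBoxCeiling`. [cite: ScalapinoWhiteZhang1993, §II] -/
theorem covNdNiO2M22Assembly_proof : Assembly := by
  unfold Assembly
  exact fun h₁ h₂ => closes h₁ h₂

end Summit.Ventures.CertifiedManyBodySolver.Theorems
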